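import Literature.AlgebraicGeometry.Resolution.PointBlowupKangaroo
import Mathlib.Algebra.CharP.Lemmas
import HarnessLib

/-!
# [OURS · L1 W4.6] Rung (iii) "Moh window" for the classical pair — a TWO-CYCLE inside the window for
  EVERY prime `p`: `x^p + y(u^p ± y^p + u^p y^p)` (surfaces)

Cell `res-hironaka`, rung L, slot W4.6, seat `res-L1-s46-pv-6` (gen 2).  Generalises the characteristic-`2`
fixed point of `MarkedTransferCampaignW46MohWindowShadeFixedPoint.lean` to every characteristic.  In the
classical model (`PointBlowup.State/step` of `PointBlowupShade.lean`, [Hauser2010, §§F–G]) consider, for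
`c ∈ K`, `c ≠ 0`, the cleaned state

  `F_c = u^p y + c·y^{p+1} + u^p y^{p+1}`,   `r = (0, 1)`   (variables `(y₀, y₁) = (u, y)`),

of order `p + 1` — INSIDE the window `p ≤ ord₀ F < 2p` — and shade `p`.  At the point `u = t` of the
`y`-chart of the blow-up of the origin with `t^p = −c`, the chart transform `u^p y + c y + u^p y^{p+1}`
translated by `u ↦ u + t` is `(u^p + t^p) y + c y + (u^p + t^p) y^{p+1} = F_{−c}` (Frobenius is additive),
nothing is cleaned, and the new multiplicities are `(0, (p+1) − p) = (0, 1)`: `step = (F_{−c}, r)`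
(`step_cyc`), and the point is equimultiple (`isEquimultiplePoint_cyc`).  With `c = 1, t = −1` and then
`c = −1, t = 1`:  `(F_1, r) ↦ (F_{−1}, r) ↦ (F_1, r)` — a TWO-CYCLE of equimultiple point blow-ups inside
the Moh window with constant shade `p`, over EVERY field of EVERY characteristic `p`
(`exists_two_cycle_in_window`, `exists_infinite_walk_in_window`; for `p = 2` the two states coincide).
Geometry: over a perfect field `F_c = y·(u + c^{1/p} y + u y)^p`, the monomial case of [HauserPerlega2024,
§3] in the parameters `(y, u + c^{1/p}y + uy)`, hidden from the coordinates; its `p`-fold locus is that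
non-coordinate curve, which the classical procedure would blow up.  Consequences for the rung: gen 0's
no-increase law `CampaignW46MohWindowShadeAntitone` (desk #35) is inhabited by infinite walks for every
`p`, and no termination statement holds for arbitrary equimultiple point sequences inside the window in
the coordinate-bound model — the positive termination results of gen 2 (terminal case, bottom edge) are
where the model allows them.  Found by the seat's Python twin, proved here symbolically in `p`.  OURS; a
NEGATIVE-SIDE calibration fact for regime (iii) of RESCUE-SEED W4.6; NOT a statement of the manuscript
[claim: Hironaka2017, status: under-review], nothing of which is used; not a claim about resolution of
singularities (cf. [HauserPerlega2019Cycles]: cycles under non-maximal centres).  AI review is weaker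
than expert review.
-/

noncomputable section

set_option linter.dupNamespace false -- mandated namespace of this single-conjunct summit

open MvPolynomial Finset

open scoped BigOperators

namespace Summit.ResolutionOfSingularities.ResolutionOfSingularities.Theorems.CampaignW46.MohWindowShadeCycle

open Literature.AlgebraicGeometry.Resolution
open Literature.AlgebraicGeometry.Resolution.PointBlowup
open Literature.AlgebraicGeometry.Resolution.Hauser2010
open Literature.Barriers.ResolutionOfSingularities (ordZero_le_of_coeff_ne_zero le_ordZero_of_forall)

variable (K : Type*) [Field K] (p : ℕ) [hp : Fact p.Prime]

/-- The residual polynomial `F_c = u^p y + c y^{p+1} + u^p y^{p+1}`. [OURS · L1 W4.6] -/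
def cycF (c : K) : MvPolynomial (Fin 2) K := X 0 ^ p * X 1 + C c * X 1 ^ (p + 1) + X 0 ^ p * X 1 ^ (p + 1)

/-- The exceptional multiplicities `r = (0, 1)`. [OURS · L1 W4.6] -/
def cycMult : Fin 2 →₀ ℕ := Finsupp.single 1 1

/-- exponent `(p, 1)`. [folklore] -/
abbrev eA : Fin 2 →₀ ℕ := Finsupp.single 0 p + Finsupp.single 1 1
/-- exponent `(0, p+1)`. [folklore] -/
abbrev eB : Fin 2 →₀ ℕ := Finsupp.single 0 0 + Finsupp.single 1 (p + 1)
/-- exponent `(p, p+1)`. [folklore] -/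
abbrev eC : Fin 2 →₀ ℕ := Finsupp.single 0 p + Finsupp.single 1 (p + 1)

omit hp in
/-- `u^a y = y^{(a,1)}`. [folklore] -/
theorem X_mul_eq (a : ℕ) :
    (X 0 ^ a * X 1 : MvPolynomial (Fin 2) K) = monomial (Finsupp.single 0 a + Finsupp.single 1 1) 1 := by
  rw [← X_pow_mul_X_pow, pow_one]

omit hp in
/-- `c·y^m = c·y^{(0,m)}`. [folklore] -/
theorem C_mul_X_pow_eq (c : K) (m : ℕ) :
    (C c * X 1 ^ m : MvPolynomial (Fin 2) K) = monomial (Finsupp.single 0 0 + Finsupp.single 1 m) c := by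
  rw [Finsupp.single_zero, zero_add, X_pow_eq_monomial, C_mul_monomial, mul_one]

omit hp in
/-- `c·y = c·y^{(0,1)}`. [folklore] -/
theorem C_mul_X_eq (c : K) :
    (C c * X 1 : MvPolynomial (Fin 2) K) = monomial (Finsupp.single 0 0 + Finsupp.single 1 1) c := by
  rw [← C_mul_X_pow_eq K c 1, pow_one]

omit hp in
/-- `F_c` as a sum of three monomials. [folklore] -/
theorem cycF_eq (c : K) : cycF K p c = monomial (eA p) 1 + monomial (eB p) c + monomial (eC p) 1 := by
  unfold cycF
  rw [X_mul_eq K p, C_mul_X_pow_eq K c (p + 1), X_pow_mul_X_pow]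

/-- the three exponents are distinct (and evaluations used below). [folklore] -/
theorem e_ne : (eA p ≠ eB p) ∧ (eA p ≠ eC p) ∧ (eB p ≠ eC p) := by
  have hp0 : p ≠ 0 := hp.out.ne_zero
  refine ⟨single_add_single_ne hp0, ?_, single_add_single_ne (Ne.symm hp0)⟩
  intro h
  have := DFunLike.congr_fun h 1
  simp at this
  omega

/-- The support of `F_c`, `c ≠ 0`. [folklore] -/
theorem support_cycF {c : K} (hc : c ≠ 0) : (cycF K p c).support = {eA p, eB p, eC p} := by
  classical
  obtain ⟨h12, h13, h23⟩ := e_ne p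
  rw [cycF_eq]
  ext d
  rw [MvPolynomial.mem_support_iff, coeff_add, coeff_add, coeff_monomial, coeff_monomial, coeff_monomial,
    Finset.mem_insert, Finset.mem_insert, Finset.mem_singleton]
  by_cases h1 : eA p = d
  · subst h1; simp [h12, h13, h12.symm, h13.symm]
  by_cases h2 : eB p = d
  · subst h2; simp [h12, h23, h12.symm, h23.symm, hc]
  by_cases h3 : eC p = d
  · subst h3; simp [h13, h23, h13.symm, h23.symm]
  simp [h1, h2, h3, Ne.symm h1, Ne.symm h2, Ne.symm h3]

/-- the coefficients of `F_c`. [folklore] -/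
theorem coeff_cycF (c : K) :
    coeff (eA p) (cycF K p c) = 1 ∧ coeff (eB p) (cycF K p c) = c ∧ coeff (eC p) (cycF K p c) = 1 := by
  classical
  obtain ⟨h12, h13, h23⟩ := e_ne p
  rw [cycF_eq]
  refine ⟨?_, ?_, ?_⟩
  · rw [coeff_add, coeff_add, coeff_monomial, coeff_monomial, coeff_monomial, if_pos rfl,
      if_neg (Ne.symm h12), if_neg (Ne.symm h13)]; simp
  · rw [coeff_add, coeff_add, coeff_monomial, coeff_monomial, coeff_monomial, if_neg h12, if_pos rfl,
      if_neg (Ne.symm h23)]; simp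
  · rw [coeff_add, coeff_add, coeff_monomial, coeff_monomial, coeff_monomial, if_neg h13, if_neg h23,
      if_pos rfl]; simp

/-- `ord₀ F_c = p + 1` (`c ≠ 0`): inside the Moh window `[p, 2p)`. [OURS · L1 W4.6] -/
theorem ordZero_cycF {c : K} (hc : c ≠ 0) : ordZero (cycF K p c) = (p + 1 : ℕ) := by
  classical
  apply le_antisymm
  · have h := ordZero_le_of_coeff_ne_zero _ _ (by rw [(coeff_cycF K p c).1]; exact one_ne_zero)
    refine le_trans h ?_
    simp [Finsupp.degree_eq_sum, Fin.sum_univ_two]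
  · refine le_ordZero_of_forall _ _ fun d hd => ?_
    have hmem : d ∈ (cycF K p c).support := MvPolynomial.mem_support_iff.mpr hd
    rw [support_cycF K p hc, Finset.mem_insert, Finset.mem_insert, Finset.mem_singleton] at hmem
    rcases hmem with rfl | rfl | rfl <;> simp [Finsupp.degree_eq_sum, Fin.sum_univ_two]

/-- `y^r ∣ F_c`: every monomial of `F_c` is divisible by `y`. [OURS · L1 W4.6] -/
theorem cycMult_le_of_mem_support {c : K} (hc : c ≠ 0) :
    ∀ d ∈ (cycF K p c).support, cycMult ≤ d := by
  intro d hd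
  rw [support_cycF K p hc, Finset.mem_insert, Finset.mem_insert, Finset.mem_singleton] at hd
  rcases hd with rfl | rfl | rfl <;> refine Finsupp.le_def.mpr fun i => ?_ <;> fin_cases i <;>
    simp [cycMult]

/-- An exponent vector on `Fin 2` whose second entry is not divisible by `q` is not a `q`-th power
exponent. [folklore] -/
theorem not_isPthPowerExponent_of_not_dvd_snd (q a : ℕ) {m : ℕ} (hm : ¬ q ∣ m) :
    ¬ IsPthPowerExponent q (Finsupp.single (0 : Fin 2) a + Finsupp.single 1 m) := by
  rw [isPthPowerExponent_iff]
  intro h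
  have h1 : (Finsupp.single (0 : Fin 2) a + Finsupp.single 1 m : Fin 2 →₀ ℕ) 1 = m := by simp
  have := h 1
  rw [h1] at this
  exact hm this

/-- `p ∤ 1` and `p ∤ p + 1`. [folklore] -/
theorem not_dvd_one_and_succ : ¬ p ∣ 1 ∧ ¬ p ∣ p + 1 := by
  have hp1 : 1 < p := hp.out.one_lt
  refine ⟨fun h => absurd (Nat.le_of_dvd one_pos h) (by omega), fun h => ?_⟩
  have : p ∣ 1 := by simpa using (Nat.dvd_add_right (dvd_refl p)).mp h
  exact absurd (Nat.le_of_dvd one_pos this) (by omega)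

/-- `F_c` is clean (`y`-exponents `1, p+1, p+1`). [OURS · L1 W4.6] -/
theorem deletePthPowers_cycF (c : K) : deletePthPowers p (cycF K p c) = cycF K p c := by
  obtain ⟨h1, h2⟩ := not_dvd_one_and_succ p
  rw [cycF_eq, deletePthPowers_add, deletePthPowers_add, deletePthPowers_monomial,
    deletePthPowers_monomial, deletePthPowers_monomial,
    if_neg (not_isPthPowerExponent_of_not_dvd_snd p p h1),
    if_neg (not_isPthPowerExponent_of_not_dvd_snd p 0 h2),
    if_neg (not_isPthPowerExponent_of_not_dvd_snd p p h2)]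

/-- The shade of `(F_c, (0,1))` is `(p + 1) − 1 = p`. [OURS · L1 W4.6] -/
theorem shade_cyc {c : K} (hc : c ≠ 0) : (State.mk (cycF K p c) cycMult).shade = (p : ℕ) := by
  rw [shade_eq_of_ordZero_eq _ (ordZero_cycF K p hc)]
  simp [cycMult, Finsupp.degree_eq_sum]

omit hp in
/-- The chart exponent of `(a, m)` in the `y`-chart (`j = 1`) at order `q`: `(a, a + m − q)`. [folklore] -/
theorem chartExponent_fin_two_q (q a m : ℕ) :
    chartExponent q (1 : Fin 2) (Finsupp.single 0 a + Finsupp.single 1 m) =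
      Finsupp.single 0 a + Finsupp.single 1 (a + m - q) := by
  ext i
  rw [chartExponent_apply]
  fin_cases i <;> simp [Finsupp.degree_eq_sum, Fin.sum_univ_two]

/-- **Chart transform** in the `y`-chart: `F_c(uy, y)/y^p = u^p y + c y + u^p y^{p+1}`. [OURS · L1 W4.6] -/
theorem chartTransform_cycF {c : K} (hc : c ≠ 0) :
    chartTransform p 1 (cycF K p c) = X 0 ^ p * X 1 + C c * X 1 + X 0 ^ p * X 1 ^ (p + 1) := by
  classical
  obtain ⟨h12, h13, h23⟩ := e_ne p
  obtain ⟨hc1, hc2, hc3⟩ := coeff_cycF K p c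
  unfold chartTransform
  rw [support_cycF K p hc, Finset.sum_insert (by simp [h12, h13]), Finset.sum_insert (by simp [h23]),
    Finset.sum_singleton, hc1, hc2, hc3, chartExponent_fin_two_q, chartExponent_fin_two_q,
    chartExponent_fin_two_q, show p + 1 - p = 1 by omega, show 0 + (p + 1) - p = 1 by omega,
    show p + (p + 1) - p = p + 1 by omega, X_mul_eq K p, C_mul_X_eq K c, X_pow_mul_X_pow]
  ring

/-- **The translation `u ↦ u + t` with `t^p = −c` gives `F_{−c}`**: Frobenius is additive, so
`(u + t)^p y + c y + (u + t)^p y^{p+1} = u^p y + (t^p + c) y + u^p y^{p+1} + t^p y^{p+1}`. [OURS · L1 W4.6] -/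
theorem pointTransform_cyc [CharP K p] {c t : K} (hc : c ≠ 0) (ht : t ^ p = -c) :
    pointTransform p 1 ![t, 0] (State.mk (cycF K p c) cycMult) = cycF K p (-c) := by
  have hfrob : (X 0 + C t : MvPolynomial (Fin 2) K) ^ p = X 0 ^ p - C c := by
    rw [add_pow_char, ← map_pow, ht, map_neg, sub_eq_add_neg]
  simp only [pointTransform, translate, chartTransform_cycF K p hc, map_add, map_mul, map_pow, aeval_X,
    aeval_C, Matrix.cons_val_zero, Matrix.cons_val_one, map_zero, add_zero, algebraMap_eq]
  rw [hfrob]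
  unfold cycF
  rw [map_neg]
  ring

variable [DecidableEq K]

/-- The new multiplicities are `(0, 1)` again. [OURS · L1 W4.6] -/
theorem newMult_cyc {c : K} (hc : c ≠ 0) (t : K) :
    newMult p 1 ![t, 0] (State.mk (cycF K p c) cycMult) = cycMult := by
  rw [newMult_eq p 1 _ (by simp) _ (ordZero_cycF K p hc)]
  ext i
  fin_cases i
  · rw [Finsupp.filter_apply]
    split_ifs <;> simp [cycMult]
  · simp [cycMult]

/-- **THE STEP `(F_c, r) ↦ (F_{−c}, r)`** at the point `u = t`, `t^p = −c`, of the `y`-chart. [OURS · L1 W4.6] -/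
theorem step_cyc [CharP K p] {c t : K} (hc : c ≠ 0) (ht : t ^ p = -c) :
    step p 1 ![t, 0] (State.mk (cycF K p c) cycMult) = State.mk (cycF K p (-c)) cycMult := by
  show State.mk (deletePthPowers p (pointTransform p 1 ![t, 0] (State.mk (cycF K p c) cycMult)))
      (newMult p 1 ![t, 0] (State.mk (cycF K p c) cycMult)) = _
  rw [pointTransform_cyc K p hc ht, deletePthPowers_cycF, newMult_cyc K p hc]

/-- **The point is equimultiple**: `F_{−c}` has order `p + 1 ≥ p`. [OURS · L1 W4.6] -/
theorem isEquimultiplePoint_cyc [CharP K p] {c t : K} (hc : c ≠ 0) (ht : t ^ p = -c) :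
    IsEquimultiplePoint p 1 ![t, 0] (State.mk (cycF K p c) cycMult) := by
  intro d _ hdeg
  rw [pointTransform_cyc K p hc ht]
  by_contra h
  have h3 := ordZero_le_of_coeff_ne_zero (cycF K p (-c)) d h
  rw [ordZero_cycF K p (neg_ne_zero.mpr hc)] at h3
  have : (p + 1 : ℕ) ≤ d.degree := by exact_mod_cast h3
  omega

/-- **[OURS · L1 W4.6] The two-cycle inside the Moh window, every characteristic.**  Over every field `K`
of characteristic `p` the states `s₁ = (F_1, (0,1))`, `s₂ = (F_{−1}, (0,1))` — cleaned, `y^r ∣ F`, order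
`p + 1` (inside the window), shade `p` — are swapped by equimultiple point blow-ups: `s₁ ↦ s₂` at the
point `u = −1` of the `y`-chart, `s₂ ↦ s₁` at the point `u = 1`.  NOT a statement of the manuscript.
[folklore] -/
theorem exists_two_cycle_in_window (K : Type*) [Field K] [CharP K p] [DecidableEq K] :
    ∃ (s₁ s₂ : State (Fin 2) K) (j : Fin 2) (b₁ b₂ : Fin 2 → K), b₁ j = 0 ∧ b₂ j = 0 ∧
      deletePthPowers p s₁.F = s₁.F ∧ deletePthPowers p s₂.F = s₂.F ∧
      (∀ d ∈ s₁.F.support, s₁.r ≤ d) ∧ (∀ d ∈ s₂.F.support, s₂.r ≤ d) ∧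
      ordZero s₁.F = (p + 1 : ℕ) ∧ ordZero s₂.F = (p + 1 : ℕ) ∧ s₁.shade = (p : ℕ) ∧ s₂.shade = (p : ℕ) ∧
      IsEquimultiplePoint p j b₁ s₁ ∧ step p j b₁ s₁ = s₂ ∧
      IsEquimultiplePoint p j b₂ s₂ ∧ step p j b₂ s₂ = s₁ := by
  have h1 : (1 : K) ≠ 0 := one_ne_zero
  have hm1 : (-1 : K) ≠ 0 := neg_ne_zero.mpr one_ne_zero
  have ht1 : (-1 : K) ^ p = -1 := neg_one_pow_char K p
  have ht2 : (1 : K) ^ p = -(-1) := by rw [one_pow, neg_neg]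
  refine ⟨State.mk (cycF K p 1) cycMult, State.mk (cycF K p (-1)) cycMult, 1, ![-1, 0], ![1, 0],
    by simp, by simp, deletePthPowers_cycF K p 1, deletePthPowers_cycF K p (-1),
    cycMult_le_of_mem_support K p h1, cycMult_le_of_mem_support K p hm1, ordZero_cycF K p h1,
    ordZero_cycF K p hm1, shade_cyc K p h1, shade_cyc K p hm1, isEquimultiplePoint_cyc K p h1 ht1,
    step_cyc K p h1 ht1, isEquimultiplePoint_cyc K p hm1 ht2, ?_⟩
  have := step_cyc K p hm1 ht2
  rw [neg_neg] at this
  exact this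

/-- **[OURS · L1 W4.6] An infinite walk of equimultiple point blow-ups INSIDE the window, every
characteristic.**  The alternating sequence `s₁, s₂, s₁, …` satisfies every hypothesis of desk #35's
`CampaignW46MohWindowShadeAntitone` for every `N`: cleaned start with `y^r ∣ F` and `ord₀ F ≥ p`, each
state the step of the previous one at an equimultiple point of the new exceptional divisor, every state of
order `p + 1 < 2p`, constant shade `p`.  NOT a statement of the manuscript. [folklore] -/
theorem exists_infinite_walk_in_window (K : Type*) [Field K] [CharP K p] [DecidableEq K] :
    ∃ (s : ℕ → State (Fin 2) K) (j : ℕ → Fin 2) (b : ℕ → Fin 2 → K),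
      (∀ n, b n (j n) = 0) ∧ (∀ n, s (n + 1) = step p (j n) (b n) (s n)) ∧
      deletePthPowers p (s 0).F = (s 0).F ∧ (∀ d ∈ (s 0).F.support, (s 0).r ≤ d) ∧
      ((p : ℕ) : ℕ∞) ≤ ordZero (s 0).F ∧ (∀ n, IsEquimultiplePoint p (j n) (b n) (s n)) ∧
      (∀ n, ordZero (s n).F < (2 * p : ℕ)) ∧ (∀ n, (s n).shade = (p : ℕ)) := by
  have h1 : (1 : K) ≠ 0 := one_ne_zero
  have hp1 : 1 < p := hp.out.one_lt
  -- the sign `ε n = (−1)^n` and the point `−ε n`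
  let ε : ℕ → K := fun n => (-1) ^ n
  have hε : ∀ n, ε n ≠ 0 := fun n => pow_ne_zero _ (neg_ne_zero.mpr one_ne_zero)
  have hεpow : ∀ n, (ε n) ^ p = ε n := by
    intro n
    show ((-1 : K) ^ n) ^ p = (-1) ^ n
    rw [← pow_mul, mul_comm, pow_mul, neg_one_pow_char K p]
  have hεp : ∀ n, (-(ε n)) ^ p = -(ε n) := by
    intro n
    rw [neg_pow, hεpow, neg_one_pow_char K p, neg_one_mul]
  have hεs : ∀ n, ε (n + 1) = -(ε n) := fun n => by
    show (-1 : K) ^ (n + 1) = -((-1) ^ n); rw [pow_succ]; ring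
  refine ⟨fun n => State.mk (cycF K p (ε n)) cycMult, fun _ => 1, fun n => ![-(ε n), 0], fun _ => by simp,
    fun n => ?_, deletePthPowers_cycF K p _, cycMult_le_of_mem_support K p (hε 0), ?_,
    fun n => isEquimultiplePoint_cyc K p (hε n) (hεp n), fun n => ?_, fun n => shade_cyc K p (hε n)⟩
  · show State.mk (cycF K p (ε (n + 1))) cycMult = step p 1 ![-(ε n), 0] (State.mk (cycF K p (ε n)) cycMult)
    rw [step_cyc K p (hε n) (hεp n), hεs]
  · show ((p : ℕ) : ℕ∞) ≤ ordZero (cycF K p (ε 0))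
    rw [ordZero_cycF K p (hε 0)]; exact_mod_cast (by omega : p ≤ p + 1)
  · show ordZero (cycF K p (ε n)) < (2 * p : ℕ)
    rw [ordZero_cycF K p (hε n)]; exact_mod_cast (by omega : p + 1 < 2 * p)

end Summit.ResolutionOfSingularities.ResolutionOfSingularities.Theorems.CampaignW46.MohWindowShadeCycle
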